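import Summits.Ventures.HodgeRepro.BallCore
import Summits.Ventures.HodgeRepro.BallTopology

/-!
# Statement (c) is tight: each hypothesis of the Hecke-translate wedge is load-bearing (seat p5)

Blind re-derivation cell `pub-hodge-repro`, seat `p5` (second seat on statement (c)).  Built on the sealer's
`BallModel.lean`, on `BallChainRule.lean` / `BallCore.lean` (action laws, the centre) and on typer-2's `BallTopology.lean`
(`isInducing_mat`).  Nothing here says anything about the status of the Hodge conjecture for CM abelian
varieties, which is NOT proved.

The sealed statement `HeckeTranslateWedge` asks, for a DENSE subgroup `Δ ≤ U(2,1)` and CONTINUOUS,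
not identically zero fields `F, G : 𝔹² → ℂ²`, for `γ ∈ Δ` and `z` with `(γ^*F)(z) ∧ G(z) ≠ 0`.  This file
records, kernel-checked, that none of the hypotheses can be dropped:

* `wedge_eq_zero_of_bot` — for the trivial subgroup `Δ = ⊥` (not dense) the conclusion fails for
  `F = G = (1, 0)`: the density hypothesis is used;
* `exists_dense_countable_subgroup` — `U(2,1)` has a COUNTABLE dense subgroup (it is second countable:
  `mat` is inducing into `ℂ^{3×3}`);
* `exists_dense_wedge_eq_zero` — for such a `Δ` there are (discontinuous) fields `F, G ≠ 0` with
  `(γ^*F)(z) ∧ G(z) = 0` for EVERY `γ ∈ Δ` and EVERY `z`: the continuity hypotheses are used — the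
  countable orbit `Δ · z₀` misses some `w₀ ∈ 𝔹²`, and `F := 1_{w₀}`, `G := 1_{z₀}` never meet;
* `dense_saturation_of_wedge` — what (c) demands of `Δ`: the conclusion for `Δ` forces every saturation
  `Δ · V` of a non-empty open set to be dense (bump fields); `dense_orbit_of_dense` — for a dense `Δ`
  every orbit is dense, so this is how the density hypothesis enters;
* `wedge_eq_zero_of_left_eq_zero` / `wedge_eq_zero_of_right_eq_zero` — `F ≠ 0`, `G ≠ 0` are needed.
-/

set_option autoImplicit false

noncomputable section

namespace Summit.Ventures.HodgeRepro

namespace BallTight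

open Matrix hiding J
open BallModel BallCore

/-! ### The density hypothesis is used: the trivial subgroup fails -/

/-- `v ∧ v = 0`. -/
theorem wedge_self (v : Fin 2 → ℂ) : wedge v v = 0 := by
  simp only [wedge]; ring

/-- For the trivial subgroup `Δ = ⊥` and the constant fields `F = G = (1, 0)` (continuous, non-zero),
every wedge `(γ^*F)(z) ∧ G(z)`, `γ ∈ ⊥`, vanishes: the conclusion of statement (c) fails without a
density-type hypothesis on `Δ`. -/
theorem wedge_eq_zero_of_bot (z : Ball) {γ : U21} (hγ : γ ∈ (⊥ : Subgroup U21)) :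
    wedge ((Jac γ z)ᵀ *ᵥ (fun _ : Ball => (![1, 0] : Fin 2 → ℂ)) (act γ z))
      ((fun _ : Ball => (![1, 0] : Fin 2 → ℂ)) z) = 0 := by
  rw [Subgroup.mem_bot] at hγ
  subst hγ
  rw [Jac_one, Matrix.transpose_one, Matrix.one_mulVec]
  exact wedge_self _

/-- The constant field `(1, 0)` is continuous and not identically zero. -/
theorem const_field_continuous_ne_zero :
    Continuous (fun _ : Ball => (![1, 0] : Fin 2 → ℂ)) ∧
      (fun _ : Ball => (![1, 0] : Fin 2 → ℂ)) ≠ 0 := by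
  refine ⟨continuous_const, ?_⟩
  intro h
  have := congrFun (congrFun h center) 0
  simp at this

/-- **Statement (c) without `Dense`**: the statement obtained by dropping the density hypothesis is false
(witness `Δ = ⊥`, `F = G = (1, 0)`). -/
theorem not_forall_subgroup :
    ¬ ∀ (Δ : Subgroup U21), ∀ (F G : Ball → (Fin 2 → ℂ)), Continuous F → Continuous G → F ≠ 0 → G ≠ 0 →
      ∃ γ ∈ Δ, ∃ z : Ball, wedge ((Jac γ z).transpose.mulVec (F (act γ z))) (G z) ≠ 0 := by
  intro h
  obtain ⟨hc, hne⟩ := const_field_continuous_ne_zero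
  obtain ⟨γ, hγ, z, hz⟩ := h ⊥ _ _ hc hc hne hne
  exact hz (wedge_eq_zero_of_bot z hγ)

/-! ### `U(2,1)` has a countable dense subgroup -/

/-- The subgroup generated by a countable set is countable. -/
theorem countable_closure {G : Type*} [Group G] {s : Set G} (hs : s.Countable) :
    (Subgroup.closure s : Set G).Countable := by
  haveI : Countable s := hs.to_subtype
  haveI : Countable (FreeGroup s) := inferInstanceAs (Countable (Quot _))
  rw [FreeGroup.closure_eq_range, MonoidHom.coe_range]
  exact Set.countable_range _

/-- `ℂ^{3×3}` is second countable (a product of countably many copies of `ℂ`). -/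
theorem secondCountableTopology_matrix : SecondCountableTopology (Matrix (Fin 3) (Fin 3) ℂ) :=
  inferInstanceAs (SecondCountableTopology (Fin 3 → Fin 3 → ℂ))

/-- `U(2,1)` is second countable (its topology is induced by `mat` into `ℂ^{3×3}`). -/
instance instSecondCountableTopologyU21 : SecondCountableTopology U21 :=
  haveI := secondCountableTopology_matrix
  isInducing_mat.secondCountableTopology

/-- `U(2,1)` has a countable dense subgroup. -/
theorem exists_dense_countable_subgroup :
    ∃ Δ : Subgroup U21, Dense (Δ : Set U21) ∧ (Δ : Set U21).Countable := by
  obtain ⟨S, hSc, hSd⟩ := TopologicalSpace.exists_countable_dense U21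
  exact ⟨Subgroup.closure S, hSd.mono Subgroup.subset_closure, countable_closure hSc⟩

/-! ### The continuity hypotheses are used: countable orbits miss points -/

/-- The point `(t, 0)` of the ball, for `-1 < t < 1`. -/
def ptOf (t : ℝ) (ht : t ∈ Set.Ioo (-1 : ℝ) 1) : Ball :=
  ⟨![(t : ℂ), 0], by
    simp only [nsq, Matrix.cons_val_zero, Matrix.cons_val_one, Matrix.cons_val_fin_one,
      Complex.norm_real, norm_zero, zero_pow two_ne_zero, add_zero, Real.norm_eq_abs, sq_abs]
    nlinarith [ht.1, ht.2]⟩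

/-- The first coordinate of `ptOf t _` is `t`. -/
theorem re_ptOf (t : ℝ) (ht : t ∈ Set.Ioo (-1 : ℝ) 1) : ((ptOf t ht).1 0).re = t := by
  simp [ptOf]

/-- A countable subset of the ball misses some point of the ball. -/
theorem exists_not_mem_of_countable {s : Set Ball} (hs : s.Countable) : ∃ w : Ball, w ∉ s := by
  have hc : ((fun z : Ball => (z.1 0).re) '' s).Countable := hs.image _
  have hI : ¬ (Set.Ioo (-1 : ℝ) 1).Countable := by
    rw [Cardinal.Real.Ioo_countable_iff]; norm_num
  have : ¬ Set.Ioo (-1 : ℝ) 1 ⊆ (fun z : Ball => (z.1 0).re) '' s := fun h => hI (hc.mono h)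
  obtain ⟨t, ht, hts⟩ := Set.not_subset.mp this
  refine ⟨ptOf t ht, fun hw => hts ⟨ptOf t ht, hw, re_ptOf t ht⟩⟩

/-- **Statement (c) without `Continuous`**: for a countable dense subgroup `Δ ≤ U(2,1)` there are
(discontinuous) fields `F, G ≠ 0` whose wedges `(γ^*F)(z) ∧ G(z)` vanish for all `γ ∈ Δ` and all `z`.
With `z₀` the centre and `w₀ ∉ Δ · z₀` (the orbit is countable), take `F := (1,0)·1_{w₀}` and
`G := (1,0)·1_{z₀}`: `G z ≠ 0` forces `z = z₀`, and then `F (γ z₀) = 0` because `γ z₀ ≠ w₀`. -/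
theorem exists_dense_wedge_eq_zero :
    ∃ Δ : Subgroup U21, Dense (Δ : Set U21) ∧
      ∃ F G : Ball → (Fin 2 → ℂ), F ≠ 0 ∧ G ≠ 0 ∧
        ∀ γ ∈ Δ, ∀ z : Ball, wedge ((Jac γ z).transpose.mulVec (F (act γ z))) (G z) = 0 := by
  classical
  obtain ⟨Δ, hΔd, hΔc⟩ := exists_dense_countable_subgroup
  set orb : Set Ball := (fun γ : U21 => act γ center) '' (Δ : Set U21) with horb
  have horbc : orb.Countable := hΔc.image _
  obtain ⟨w₀, hw₀⟩ := exists_not_mem_of_countable horbc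
  refine ⟨Δ, hΔd, fun w => if w = w₀ then ![1, 0] else 0,
    fun z => if z = center then ![1, 0] else 0, ?_, ?_, ?_⟩
  · intro h
    have := congrFun (congrFun h w₀) 0
    simp at this
  · intro h
    have := congrFun (congrFun h center) 0
    simp at this
  · intro γ hγ z
    by_cases hz : z = center
    · subst hz
      have hne : act γ center ≠ w₀ := fun h => hw₀ ⟨γ, hγ, h⟩
      simp [hne, wedge]
    · simp [hz, wedge]

/-- **Statement (c) without `Continuous`**, as a single negated proposition: dropping the two
continuity hypotheses from `HeckeTranslateWedge` makes it false. -/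
theorem not_forall_discontinuous :
    ¬ ∀ (Δ : Subgroup U21), Dense (Δ : Set U21) →
      ∀ (F G : Ball → (Fin 2 → ℂ)), F ≠ 0 → G ≠ 0 →
        ∃ γ ∈ Δ, ∃ z : Ball, wedge ((Jac γ z).transpose.mulVec (F (act γ z))) (G z) ≠ 0 := by
  intro h
  obtain ⟨Δ, hΔ, F, G, hF, hG, hzero⟩ := exists_dense_wedge_eq_zero
  obtain ⟨γ, hγ, z, hz⟩ := h Δ hΔ F G hF hG
  exact hz (hzero γ hγ z)

/-! ### What statement (c) says about `Δ`: saturations of open sets are dense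

For a continuous field supported in an open set `U` and another supported in an open set `V`, the
wedge `(γ^*F)(z) ∧ G(z)` can only be non-zero when `z ∈ V` and `γ z ∈ U`.  So the conclusion of (c) for a
subgroup `Δ` forces `Δ · V` to meet every non-empty open `U`: every saturation `Δ · V` is dense.  For a
dense `Δ` this holds (indeed every ORBIT is dense, `dense_orbit_of_dense`); the sealed hypothesis
`Dense Δ` is thus used exactly through this topological transitivity plus the isotropy rotation of
`BallCore.exists_wedge_ne_zero`. -/

/-- The bump field `w ↦ max(0, r − |w − w₀|) · (1, 0)` (distance in `ℂ²`). -/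
def bump (w₀ : Ball) (r : ℝ) (w : Ball) : Fin 2 → ℂ :=
  ((max 0 (r - dist w.1 w₀.1) : ℝ) : ℂ) • (![1, 0] : Fin 2 → ℂ)

/-- The bump field is continuous. -/
theorem continuous_bump (w₀ : Ball) (r : ℝ) : Continuous (bump w₀ r) := by
  unfold bump
  exact (Complex.continuous_ofReal.comp
    (continuous_const.max (continuous_const.sub (continuous_ball_val.dist continuous_const)))).smul
    continuous_const

/-- The bump field is non-zero at its centre when `r > 0`. -/
theorem bump_center_ne_zero (w₀ : Ball) {r : ℝ} (hr : 0 < r) : bump w₀ r w₀ ≠ 0 := by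
  intro h
  have := congrFun h 0
  simp only [bump, dist_self, sub_zero, Pi.smul_apply, Matrix.cons_val_zero, smul_eq_mul, mul_one,
    Pi.zero_apply, Complex.ofReal_eq_zero] at this
  linarith [le_max_right (0 : ℝ) r]

/-- The bump field vanishes outside the `r`-ball around `w₀`. -/
theorem bump_eq_zero {w₀ : Ball} {r : ℝ} {w : Ball} (hw : ¬ dist w.1 w₀.1 < r) : bump w₀ r w = 0 := by
  have h0 : max 0 (r - dist w.1 w₀.1) = 0 := max_eq_left (by linarith [not_lt.mp hw])
  simp [bump, h0]

/-- The bump field is non-zero only inside the `r`-ball around `w₀`. -/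
theorem dist_lt_of_bump_ne_zero {w₀ : Ball} {r : ℝ} {w : Ball} (hw : bump w₀ r w ≠ 0) :
    dist w.1 w₀.1 < r := by
  by_contra h
  exact hw (bump_eq_zero h)

/-- An open subset of the ball containing `w₀` contains a `dist`-ball `{w | dist w.1 w₀.1 < r}`, `r > 0`
(the ball carries the subspace topology of `ℂ²`). -/
theorem exists_radius_subset {U : Set Ball} (hU : IsOpen U) {w₀ : Ball} (hw₀ : w₀ ∈ U) :
    ∃ r > 0, ∀ w : Ball, dist w.1 w₀.1 < r → w ∈ U := by
  have hind : Topology.IsInducing (Subtype.val : Ball → (Fin 2 → ℂ)) := Topology.IsInducing.subtypeVal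
  obtain ⟨U', hU'o, hU'eq⟩ := hind.isOpen_iff.mp hU
  have hw₀' : w₀.1 ∈ U' := by rw [← hU'eq] at hw₀; exact hw₀
  obtain ⟨r, hr, hball⟩ := Metric.isOpen_iff.mp hU'o w₀.1 hw₀'
  refine ⟨r, hr, fun w hw => ?_⟩
  rw [← hU'eq]
  exact hball (Metric.mem_ball.mpr hw)

/-- **Necessary condition on `Δ`.**  If the conclusion of statement (c) holds for a subgroup `Δ ≤ U(2,1)`
(for all continuous non-zero fields), then for every non-empty open `V ⊆ 𝔹²` the saturation
`Δ · V = ⋃_{γ ∈ Δ} γ V` is dense in `𝔹²`. -/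
theorem dense_saturation_of_wedge (Δ : Subgroup U21)
    (hc : ∀ (F G : Ball → (Fin 2 → ℂ)), Continuous F → Continuous G → F ≠ 0 → G ≠ 0 →
      ∃ γ ∈ Δ, ∃ z : Ball, wedge ((Jac γ z).transpose.mulVec (F (act γ z))) (G z) ≠ 0)
    {V : Set Ball} (hV : IsOpen V) (hVne : V.Nonempty) :
    Dense (⋃ γ ∈ Δ, act γ '' V) := by
  rw [dense_iff_inter_open]
  intro U hU hUne
  by_contra hempty
  rw [Set.not_nonempty_iff_eq_empty] at hempty
  obtain ⟨w₀, hw₀⟩ := hUne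
  obtain ⟨z₀, hz₀⟩ := hVne
  obtain ⟨r, hr, hrU⟩ := exists_radius_subset hU hw₀
  obtain ⟨r', hr', hrV⟩ := exists_radius_subset hV hz₀
  have hF0 : bump w₀ r ≠ 0 := fun h => bump_center_ne_zero w₀ hr (by rw [h]; rfl)
  have hG0 : bump z₀ r' ≠ 0 := fun h => bump_center_ne_zero z₀ hr' (by rw [h]; rfl)
  obtain ⟨γ, hγ, z, hz⟩ := hc _ _ (continuous_bump w₀ r) (continuous_bump z₀ r') hF0 hG0
  have hGz : bump z₀ r' z ≠ 0 := by
    intro h; apply hz; rw [h]; simp [wedge]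
  have hFz : bump w₀ r (act γ z) ≠ 0 := by
    intro h; apply hz; rw [h]; simp [wedge]
  have hzV : z ∈ V := hrV z (dist_lt_of_bump_ne_zero hGz)
  have hU' : act γ z ∈ U := hrU _ (dist_lt_of_bump_ne_zero hFz)
  have hsat : act γ z ∈ ⋃ γ ∈ Δ, act γ '' V := Set.mem_iUnion₂.mpr ⟨γ, hγ, z, hzV, rfl⟩
  have : act γ z ∈ U ∩ ⋃ γ ∈ Δ, act γ '' V := ⟨hU', hsat⟩
  rw [hempty] at this
  exact this

/-- For a dense subgroup `Δ ≤ U(2,1)` every orbit `Δ · z` is dense in the ball (transitivity of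
`U(2,1)` and continuity of `γ ↦ γ z`). -/
theorem dense_orbit_of_dense {Δ : Subgroup U21} (hΔ : Dense (Δ : Set U21)) (z : Ball) :
    Dense ((fun γ : U21 => act γ z) '' (Δ : Set U21)) := by
  have hsurj : Function.Surjective (fun γ : U21 => act γ z) := fun w => exists_act_eq z w
  exact hsurj.denseRange.dense_image (continuous_act_left z) hΔ

/-- For a dense subgroup the saturation of every non-empty set is dense (it contains an orbit). -/
theorem dense_saturation_of_dense {Δ : Subgroup U21} (hΔ : Dense (Δ : Set U21)) {V : Set Ball}
    (hVne : V.Nonempty) : Dense (⋃ γ ∈ Δ, act γ '' V) := by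
  obtain ⟨z₀, hz₀⟩ := hVne
  refine (dense_orbit_of_dense hΔ z₀).mono ?_
  rintro w ⟨γ, hγ, rfl⟩
  exact Set.mem_iUnion₂.mpr ⟨γ, hγ, z₀, hz₀, rfl⟩

/-! ### `F ≠ 0` and `G ≠ 0` are used -/

/-- If `F = 0` every wedge vanishes. -/
theorem wedge_eq_zero_of_left_eq_zero (γ : U21) (z : Ball) (G : Ball → Fin 2 → ℂ) :
    wedge ((Jac γ z).transpose.mulVec ((0 : Ball → Fin 2 → ℂ) (act γ z))) (G z) = 0 := by
  simp [wedge]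

/-- If `G = 0` every wedge vanishes. -/
theorem wedge_eq_zero_of_right_eq_zero (γ : U21) (z : Ball) (F : Ball → Fin 2 → ℂ) :
    wedge ((Jac γ z).transpose.mulVec (F (act γ z))) ((0 : Ball → Fin 2 → ℂ) z) = 0 := by
  simp [wedge]

end BallTight

end Summit.Ventures.HodgeRepro

end
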